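import Mathlib
import Summits.Ventures.PercRepro2.KPrimeCycle5Base
import Summits.Ventures.PercRepro2.KPrimeCycle5Cert1
import Summits.Ventures.PercRepro2.KPrimeCycle5Cert2
import Summits.Ventures.PercRepro2.KPrimeCycle5Cert3
import Summits.Ventures.PercRepro2.KPrimeCycle5Cert4
import Summits.Ventures.PercRepro2.KPrimeCycle5Cert5
import Summits.Ventures.PercRepro2.KPrimeCycle5Cert6
import Summits.Ventures.PercRepro2.CycleArcs

/-!
# `(K′)` on every cycle (blind cell PercRepro2, mine-c g41; `conjectures/MINE-C.md` §50)

**`kprime_cycle`**: for the `n`-cycle `cycN n` (`V = E = Fin n`), every admissible weight vector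
and every placement of the five distinct marks `a₁, a₂, b, v, y`, the lemma of record `(K′)` of
the `(C-MONO)` chain holds: `KPrime.KPrimeHolds (cycN n) a₁ a₂ b v y p` — the first unconditional
infinite family for `(K′)` beyond its pendant and degenerate loci.

Proof.  Sort the marks (`Finset.orderEmbOfFin`): the mark connectivities of the cycle under `ω`
are those of `C₅` under the arc pattern `arcOpen ω` (`conn_marks_iff`), whose law is the product
law of the arc weights `arcProb` (`prob_arcOpen_preimage`); every event of the `(K′)` form is a
Boolean combination of mark connectivities, so the form transports (`kprimeForm_transport'`,
`kprimeHolds_transport'` — the `(K′)` form of typer-1's `Cycle.Gc_transport'`).  On `C₅` a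
ROTATION of the cycle (`prob_comp_equiv`, `conn_cycN_shift`) puts `a₁` at `0`
(`kprime_cycle5_all`), and the `24` placements with `a₁ = 0` are the tensor-Bernstein certificates
of `KPrimeCycle5Cert1–6.lean` (`kprime_cycle5_zero`).  No closed forms beyond `C₅`.
-/

namespace Summit.Ventures.PercRepro2

namespace KPrimeCycle

open Cycle

/-! ## Transport of the `(K′)` form across vertex and edge types -/

section Transport

variable {V : Type*} {E : Type*} {V' : Type*} {E' : Type*} [Fintype E] [DecidableEq E]
  [Fintype E'] [DecidableEq E'] [DecidableEq V] [DecidableEq V'] {R : Type*} [Field R]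

omit [Fintype E] [DecidableEq E] [Fintype E'] [DecidableEq E'] [DecidableEq V] [DecidableEq V'] in
/-- The preimage of a connection event under a configuration map transporting connectivity. -/
lemma preimage_connEvent' {ends : E → Sym2 V} {ends' : E' → Sym2 V'} {Ψ : Config E' → Config E}
    {φ : V → V'} (hH : ∀ ω x z, Conn ends (Ψ ω) x z ↔ Conn ends' ω (φ x) (φ z)) (x z : V) :
    Ψ ⁻¹' connEvent ends x z = connEvent ends' (φ x) (φ z) := by
  ext ω
  simp [hH]

omit [Fintype E] [DecidableEq E] [Fintype E'] [DecidableEq E'] [DecidableEq V] [DecidableEq V'] in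
/-- The preimage of a one-point avoidance event. -/
lemma preimage_avoidAll_singleton' {ends : E → Sym2 V} {ends' : E' → Sym2 V'}
    {Ψ : Config E' → Config E} {φ : V → V'}
    (hH : ∀ ω x z, Conn ends (Ψ ω) x z ↔ Conn ends' ω (φ x) (φ z)) (s x : V) :
    Ψ ⁻¹' avoidAll ends s {x} = avoidAll ends' (φ s) {φ x} := by
  ext ω
  simp [avoidAll, hH]

omit [Fintype E] [DecidableEq E] [Fintype E'] [DecidableEq E'] in
/-- The preimage of a two-point avoidance event. -/
lemma preimage_avoidAll_pair' {ends : E → Sym2 V} {ends' : E' → Sym2 V'}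
    {Ψ : Config E' → Config E} {φ : V → V'}
    (hH : ∀ ω x z, Conn ends (Ψ ω) x z ↔ Conn ends' ω (φ x) (φ z)) (s x z : V) :
    Ψ ⁻¹' avoidAll ends s {x, z} = avoidAll ends' (φ s) {φ x, φ z} := by
  ext ω
  simp [avoidAll, hH]

/-- **Transport of the `(K′)` form across types**: if `P_q(A) = P_p(Ψ⁻¹ A)` for every event and
`Ψ` carries `Conn ends` to `Conn ends'` along the vertex map `φ`, then `kprimeForm` is carried
along (the `(K′)` form of `Cycle.Gc_transport'`). -/
theorem kprimeForm_transport' {q : E → R} {p : E' → R} {ends : E → Sym2 V}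
    {ends' : E' → Sym2 V'} {Ψ : Config E' → Config E} {φ : V → V'}
    (hP : ∀ A : Set (Config E), prob q A = prob p (Ψ ⁻¹' A))
    (hH : ∀ ω x z, Conn ends (Ψ ω) x z ↔ Conn ends' ω (φ x) (φ z)) (a₁ a₂ b v y : V)
    (N₀ D₀ : R) :
    KPrime.kprimeForm ends a₁ a₂ b v y q N₀ D₀ =
      KPrime.kprimeForm ends' (φ a₁) (φ a₂) (φ b) (φ v) (φ y) p N₀ D₀ := by
  simp only [KPrime.kprimeForm, KPrime.cls01e, KPrime.cls01, KPrime.S, KPrime.Ω, hP,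
    Set.preimage_inter, Set.preimage_union, Set.preimage_compl, preimage_connEvent' hH,
    preimage_avoidAll_singleton' hH, preimage_avoidAll_pair' hH]

variable [LinearOrder R]

/-- **Transport of `(K′)` across types.** -/
theorem kprimeHolds_transport' {q : E → R} {p : E' → R} {ends : E → Sym2 V}
    {ends' : E' → Sym2 V'} {Ψ : Config E' → Config E} {φ : V → V'}
    (hP : ∀ A : Set (Config E), prob q A = prob p (Ψ ⁻¹' A))
    (hH : ∀ ω x z, Conn ends (Ψ ω) x z ↔ Conn ends' ω (φ x) (φ z)) (a₁ a₂ b v y : V) :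
    KPrime.KPrimeHolds ends a₁ a₂ b v y q ↔
      KPrime.KPrimeHolds ends' (φ a₁) (φ a₂) (φ b) (φ v) (φ y) p := by
  simp only [KPrime.KPrimeHolds, kprimeForm_transport' hP hH, hP, KPrime.N, Set.preimage_inter,
    preimage_connEvent' hH, preimage_avoidAll_pair' hH]

end Transport

/-! ## Relabelling the edges -/

section Relabel

variable {E : Type*} {E' : Type*} [Fintype E] [DecidableEq E] [Fintype E'] [DecidableEq E']
  {R : Type*} [CommRing R]

omit [DecidableEq E] [DecidableEq E'] in
/-- The weight of a configuration is invariant under relabelling the edges. -/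
lemma weight_comp (σ : E' ≃ E) (p : E → R) (ω : Config E) :
    weight (p ∘ σ) (ω ∘ σ) = weight p ω := by
  unfold weight
  exact Fintype.prod_equiv σ _ _ (fun _ => rfl)

/-- **Relabelling the edges**: `P_{p ∘ σ}(A) = P_p({ω | ω ∘ σ ∈ A})`. -/
theorem prob_comp_equiv (σ : E' ≃ E) (p : E → R) (A : Set (Config E')) :
    prob (p ∘ σ) A = prob p ((fun ω : Config E => ω ∘ σ) ⁻¹' A) := by
  classical
  unfold prob
  refine (Fintype.sum_equiv (Equiv.arrowCongr σ.symm (Equiv.refl Bool)) _ _ fun ω => ?_).symm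
  have hω : (Equiv.arrowCongr σ.symm (Equiv.refl Bool)) ω = ω ∘ σ := by
    ext e; simp [Equiv.arrowCongr_apply]
  rw [hω]
  by_cases h : ω ∘ σ ∈ A
  · rw [Set.indicator_of_mem h, Set.indicator_of_mem (by simpa using h), weight_comp]
  · rw [Set.indicator_of_notMem h, Set.indicator_of_notMem (by simpa using h)]

end Relabel

/-! ## Rotating the cycle -/

section Rotate

variable {n : ℕ} [NeZero n]

/-- Distances are invariant under a common shift. -/
lemma dist_sub_sub (u x k : Fin n) : dist (u - k) (x - k) = dist u x := by
  simp only [Cycle.dist, sub_sub_sub_cancel_right]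

/-- Membership in an upward arc is invariant under a common shift. -/
lemma mem_upInterval_sub {u v i k : Fin n} :
    i - k ∈ upInterval (u - k) (v - k) ↔ i ∈ upInterval u v := by
  simp only [mem_upInterval, dist_sub_sub]

/-- The configurations along a shifted arc. -/
lemma forall_upInterval_sub (ω : Config (Fin n)) (u v k : Fin n) :
    (∀ i ∈ upInterval u v, ω (i - k) = true) ↔ ∀ j ∈ upInterval (u - k) (v - k), ω j = true := by
  constructor
  · intro h j hj
    have hj' : (j + k) - k ∈ upInterval (u - k) (v - k) := by rwa [add_sub_cancel_right]
    have := h (j + k) (mem_upInterval_sub.1 hj')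
    rwa [add_sub_cancel_right] at this
  · intro h i hi
    exact h (i - k) (mem_upInterval_sub.2 hi)

/-- **Rotating the cycle**: connectivity under the shifted configuration `i ↦ ω (i - k)` is
connectivity under `ω` between the shifted vertices. -/
theorem conn_cycN_shift (ω : Config (Fin n)) (k x z : Fin n) :
    Conn (cycN n) (fun i => ω (i - k)) x z ↔ Conn (cycN n) ω (x - k) (z - k) := by
  rw [conn_cycle_iff, conn_cycle_iff, forall_upInterval_sub ω x z k, forall_upInterval_sub ω z x k]

/-- The shift `i ↦ i + k` of `Fin n` as an equivalence (inverse `i ↦ i - k`). -/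
def shiftEquiv (k : Fin n) : Fin n ≃ Fin n where
  toFun i := i + k
  invFun i := i - k
  left_inv i := add_sub_cancel_right i k
  right_inv i := sub_add_cancel i k

end Rotate

/-! ## `(K′)` on the 5-cycle at every placement -/

section Cycle5

variable {R : Type*} [Field R] [LinearOrder R] [IsStrictOrderedRing R]

set_option maxHeartbeats 400000 in
/-- `(K′)` on `C₅` at every placement with `a₁ = 0`: the `24` certificates. -/
theorem kprime_cycle5_zero (w : Fin 5 → R) (hw : IsProbVec w) (a₂ b v y : Fin 5)
    (h02 : (0 : Fin 5) ≠ a₂) (h0b : (0 : Fin 5) ≠ b) (h0v : (0 : Fin 5) ≠ v) (h0y : (0 : Fin 5) ≠ y)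
    (h2b : a₂ ≠ b) (h2v : a₂ ≠ v) (h2y : a₂ ≠ y) (hbv : b ≠ v) (hby : b ≠ y) (hvy : v ≠ y) :
    KPrime.KPrimeHolds (cycN 5) 0 a₂ b v y w := by
  fin_cases a₂ <;> fin_cases b <;> fin_cases v <;> fin_cases y <;>
    first
    | exact absurd rfl h02 | exact absurd rfl h0b | exact absurd rfl h0v | exact absurd rfl h0y
    | exact absurd rfl h2b | exact absurd rfl h2v | exact absurd rfl h2y | exact absurd rfl hbv
    | exact absurd rfl hby | exact absurd rfl hvy
    | exact KPrimeCycle5.kprime_01234 w hw | exact KPrimeCycle5.kprime_01243 w hw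
    | exact KPrimeCycle5.kprime_01324 w hw | exact KPrimeCycle5.kprime_01342 w hw
    | exact KPrimeCycle5.kprime_01423 w hw | exact KPrimeCycle5.kprime_01432 w hw
    | exact KPrimeCycle5.kprime_02134 w hw | exact KPrimeCycle5.kprime_02143 w hw
    | exact KPrimeCycle5.kprime_02314 w hw | exact KPrimeCycle5.kprime_02341 w hw
    | exact KPrimeCycle5.kprime_02413 w hw | exact KPrimeCycle5.kprime_02431 w hw
    | exact KPrimeCycle5.kprime_03124 w hw | exact KPrimeCycle5.kprime_03142 w hw
    | exact KPrimeCycle5.kprime_03214 w hw | exact KPrimeCycle5.kprime_03241 w hw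
    | exact KPrimeCycle5.kprime_03412 w hw | exact KPrimeCycle5.kprime_03421 w hw
    | exact KPrimeCycle5.kprime_04123 w hw | exact KPrimeCycle5.kprime_04132 w hw
    | exact KPrimeCycle5.kprime_04213 w hw | exact KPrimeCycle5.kprime_04231 w hw
    | exact KPrimeCycle5.kprime_04312 w hw | exact KPrimeCycle5.kprime_04321 w hw

/-- **`(K′)` on the `5`-cycle for every admissible weight vector and every placement of the five
distinct marks**: rotate the cycle so that `a₁` sits at `0` and use the certificates. -/
theorem kprime_cycle5_all (w : Fin 5 → R) (hw : IsProbVec w) (a₁ a₂ b v y : Fin 5)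
    (h12 : a₁ ≠ a₂) (h1b : a₁ ≠ b) (h1v : a₁ ≠ v) (h1y : a₁ ≠ y) (h2b : a₂ ≠ b) (h2v : a₂ ≠ v)
    (h2y : a₂ ≠ y) (hbv : b ≠ v) (hby : b ≠ y) (hvy : v ≠ y) :
    KPrime.KPrimeHolds (cycN 5) a₁ a₂ b v y w := by
  set σ : Fin 5 ≃ Fin 5 := shiftEquiv a₁ with hσ
  set w' : Fin 5 → R := w ∘ σ with hw'
  have hw'p : IsProbVec w' := ⟨fun i => hw.nonneg _, fun i => hw.le_one _⟩
  have hP : ∀ A : Set (Config (Fin 5)),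
      prob w A = prob w' ((fun ω : Config (Fin 5) => fun i => ω (i - a₁)) ⁻¹' A) := by
    intro A
    have h := prob_comp_equiv σ.symm w' A
    have hw'' : w' ∘ σ.symm = w := by
      ext i
      simp [hw', Function.comp, hσ, shiftEquiv, sub_add_cancel]
    rw [hw''] at h
    exact h
  have hH : ∀ (ω : Config (Fin 5)) (x z : Fin 5),
      Conn (cycN 5) ((fun ω : Config (Fin 5) => fun i => ω (i - a₁)) ω) x z ↔
        Conn (cycN 5) ω (x - a₁) (z - a₁) := fun ω x z => conn_cycN_shift ω a₁ x z
  rw [kprimeHolds_transport' hP hH, sub_self]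
  refine kprime_cycle5_zero w' hw'p (a₂ - a₁) (b - a₁) (v - a₁) (y - a₁) ?_ ?_ ?_ ?_ ?_ ?_ ?_
    ?_ ?_ ?_
  · exact fun h => h12 (sub_eq_zero.1 h.symm).symm
  · exact fun h => h1b (sub_eq_zero.1 h.symm).symm
  · exact fun h => h1v (sub_eq_zero.1 h.symm).symm
  · exact fun h => h1y (sub_eq_zero.1 h.symm).symm
  · exact fun h => h2b (sub_left_injective h)
  · exact fun h => h2v (sub_left_injective h)
  · exact fun h => h2y (sub_left_injective h)
  · exact fun h => hbv (sub_left_injective h)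
  · exact fun h => hby (sub_left_injective h)
  · exact fun h => hvy (sub_left_injective h)

end Cycle5

/-! ## `(K′)` on every cycle -/

section Theorem

variable {n : ℕ} [NeZero n]
variable {R : Type*} [Field R] [LinearOrder R] [IsStrictOrderedRing R]

/-- The five marks of a cycle instance as a finset. -/
def marks (a₁ a₂ b v y : Fin n) : Finset (Fin n) := {a₁, a₂, b, v, y}

omit [NeZero n] in
/-- Five distinct marks are five points. -/
lemma card_marks (a₁ a₂ b v y : Fin n) (h12 : a₁ ≠ a₂) (h1b : a₁ ≠ b) (h1v : a₁ ≠ v)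
    (h1y : a₁ ≠ y) (h2b : a₂ ≠ b) (h2v : a₂ ≠ v) (h2y : a₂ ≠ y) (hbv : b ≠ v) (hby : b ≠ y)
    (hvy : v ≠ y) : (marks a₁ a₂ b v y).card = 5 := by
  unfold marks
  rw [Finset.card_insert_of_notMem (by simp [h12, h1b, h1v, h1y]),
    Finset.card_insert_of_notMem (by simp [h2b, h2v, h2y]),
    Finset.card_insert_of_notMem (by simp [hbv, hby]),
    Finset.card_insert_of_notMem (by simp [hvy]), Finset.card_singleton]

omit [NeZero n] in
/-- Every mark is a sorted mark. -/
lemma exists_orderEmb_eq {M : Finset (Fin n)} (hM : M.card = 5) {x : Fin n} (hx : x ∈ M) :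
    ∃ k : Fin 5, M.orderEmbOfFin hM k = x := by
  have h := Finset.range_orderEmbOfFin M hM
  rw [← Finset.mem_coe, ← h] at hx
  exact hx

/-- **`(K′)` on the `n`-cycle for every admissible weight vector and every placement of the five
distinct marks** (`MINE-C.md` §50): the mark connectivities of the cycle are those of `C₅` with the
independent arc weights `arcProb` (`conn_marks_iff`, `prob_arcOpen_preimage`), so `(K′)`
transports to `C₅` (`kprimeHolds_transport'`), where it holds at every placement
(`kprime_cycle5_all`). -/
theorem kprime_cycle (p : Fin n → R) (hp : IsProbVec p) (a₁ a₂ b v y : Fin n) (h12 : a₁ ≠ a₂)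
    (h1b : a₁ ≠ b) (h1v : a₁ ≠ v) (h1y : a₁ ≠ y) (h2b : a₂ ≠ b) (h2v : a₂ ≠ v) (h2y : a₂ ≠ y)
    (hbv : b ≠ v) (hby : b ≠ y) (hvy : v ≠ y) : KPrime.KPrimeHolds (cycN n) a₁ a₂ b v y p := by
  have hM := card_marks a₁ a₂ b v y h12 h1b h1v h1y h2b h2v h2y hbv hby hvy
  set qe := (marks a₁ a₂ b v y).orderEmbOfFin hM with hqe
  have hq : StrictMono (⇑qe) := qe.strictMono
  obtain ⟨k₁, hk₁⟩ := exists_orderEmb_eq hM (x := a₁) (by simp [marks])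
  obtain ⟨k₂, hk₂⟩ := exists_orderEmb_eq hM (x := a₂) (by simp [marks])
  obtain ⟨kb, hkb⟩ := exists_orderEmb_eq hM (x := b) (by simp [marks])
  obtain ⟨kv, hkv⟩ := exists_orderEmb_eq hM (x := v) (by simp [marks])
  obtain ⟨ky, hky⟩ := exists_orderEmb_eq hM (x := y) (by simp [marks])
  rw [← hqe] at hk₁ hk₂ hkb hkv hky
  have key : KPrime.KPrimeHolds (cycN n) a₁ a₂ b v y p ↔
      KPrime.KPrimeHolds (cycN 5) k₁ k₂ kb kv ky (arcProb (⇑qe) p) := by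
    rw [← hk₁, ← hk₂, ← hkb, ← hkv, ← hky]
    exact (kprimeHolds_transport' (fun A => (prob_arcOpen_preimage hq p A).symm)
      (fun ω x z => (conn_marks_iff hq ω x z).symm) k₁ k₂ kb kv ky).symm
  have d12 : k₁ ≠ k₂ := fun h => h12 (by rw [← hk₁, ← hk₂, h])
  have d1b : k₁ ≠ kb := fun h => h1b (by rw [← hk₁, ← hkb, h])
  have d1v : k₁ ≠ kv := fun h => h1v (by rw [← hk₁, ← hkv, h])
  have d1y : k₁ ≠ ky := fun h => h1y (by rw [← hk₁, ← hky, h])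
  have d2b : k₂ ≠ kb := fun h => h2b (by rw [← hk₂, ← hkb, h])
  have d2v : k₂ ≠ kv := fun h => h2v (by rw [← hk₂, ← hkv, h])
  have d2y : k₂ ≠ ky := fun h => h2y (by rw [← hk₂, ← hky, h])
  have dbv : kb ≠ kv := fun h => hbv (by rw [← hkb, ← hkv, h])
  have dby : kb ≠ ky := fun h => hby (by rw [← hkb, ← hky, h])
  have dvy : kv ≠ ky := fun h => hvy (by rw [← hkv, ← hky, h])
  rw [key]
  exact kprime_cycle5_all (arcProb (⇑qe) p) (isProbVec_arcProb (⇑qe) hp) k₁ k₂ kb kv ky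
    d12 d1b d1v d1y d2b d2v d2y dbv dby dvy

end Theorem

end KPrimeCycle

end Summit.Ventures.PercRepro2
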